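import Summits.HodgeConjecture.HodgeConjecture.Theorems.Ring2WeilCoverageNormCriteria
import Summits.HodgeConjecture.HodgeConjecture.Theorems.Ring2WeilNormObstructionDescentCensus
import HarnessLib

/-!
# Weil-type family coverage — norm classes of the `2.A₇`-carrier fourfolds on W4.7.3 (ring2-b06, gen 100)

research route conditional on HC_CM; not a corollary; Q11.4-sentence-2 already refuted in dim ≥ 3.

Ring 2, WEIL-TYPE FAMILY-COVERAGE CENSUS (`HOME/WEIL-FAMILY-COVERAGE.md`, section `## b06`, block b06.22 P.S. 2, owner
ring2-b06).  That block introduces the carrier `2.A₇` (the spin double cover of `A₇ ⊂ SO(7)`, with its faithful half-spin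
character `χ₄`, `ℚ(χ₄) = ℚ(√-7)`) and reads, exactly on a 720-sheet quotient curve of genus 178, the hidden factor of the
rigid `2.A₇ × S₃`-cover of `ℙ¹` with branch datum `(0; 3B̂:3, 7Â:2, 14B̂:2)` (genus 7 921) and of its complex-conjugate
datum `(0; 3B̂:3, 14Â:2, 7B̂:2)`: Weil-type abelian FOURFOLDS over `ℚ(√-7)` of signature `(2,2)` with literal hermitian
determinants `det_K H = 2¹²·3⁵·5⁴ = 622080000` and `2¹³·3⁵·5⁴ = 1244160000`.  Those are exact topological computations of
the census, not kernel statements.  THIS FILE pins their ARITHMETIC: both classes in `ℚˣ/Nm(ℚ(√-7)ˣ)` equal `[3]`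
(`622080000 = 3·14400²`, `1244160000 = 6·14400²` and `2 = Nm((1+√-7)/2)`), which is NOT the split class `[(-1)²] = [1]` of the
fourfold row — these are members of the NON-split component W4.7.3 = `(2, ℚ(√-7), a ≡ 3)`, the first curve-carried members of
a non-split `ℚ(√-7)` Weil fourfold row in the census.  The non-split statement is the tree's `three_ne_split_seven_of_even`
(`3 ∉ Nm(ℚ(√-7)ˣ)`, ring2-b02's uniform descent).

No `def`, no named fact, no `sorry`; nothing here is a statement about Hodge classes; `HC_CM` is used nowhere.

References: [cite: vanGeemen1994HodgeAV, 5.2 and (5.4.1)].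
-/

noncomputable section

set_option linter.dupNamespace false

open Literature.AlgebraicGeometry.Motives
open Literature.AlgebraicGeometry.VanGeemen1994
open Summit.HodgeConjecture.HodgeConjecture.Ring2.Hypotheses
open Summit.HodgeConjecture.Ring2WeilNormDescent

namespace Summit.HodgeConjecture.HodgeConjecture.Ring2.WeilCoverage

/-- **`2.A₇ × S₃`, `(0; 3B̂:3, 7Â:2, 14B̂:2)` (genus 7 921; 720-sheet quotient of genus 178; `ℚ(√-7)`-signature `(2,2)`): literal
`det_K H = 2¹²·3⁵·5⁴ = 622080000`; `622080000⁻¹·3 = 1/207360000 = (1/14400)²` is a norm from `ℚ(√-7)`, so the class is `[3]`.**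
research route conditional on HC_CM; not a corollary; Q11.4-sentence-2 already refuted in dim ≥ 3. [cite: vanGeemen1994HodgeAV, (5.4.1)] -/
theorem twoA7xS3_3B_7A_14B_mk_detH_eq_three :
    (QuotientGroup.mk (Units.mk0 (622080000 : ℚ) (by norm_num)) : weilNormResidueGroup 7) =
      QuotientGroup.mk (Units.mk0 (3 : ℚ) (by norm_num)) := by
  rw [QuotientGroup.eq]
  have e : (Units.mk0 (622080000 : ℚ) (by norm_num))⁻¹ * Units.mk0 (3 : ℚ) (by norm_num) =
      Units.mk0 ((1 : ℚ) / 207360000) (by norm_num) := Units.ext (by norm_num)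
  rw [e]
  exact mem_normUnitsSubgroup_of_sq_add_mul_sq _ ((1 : ℚ) / 14400) 0 (by norm_num)

/-- … hence NOT the split class `[(-1)²] = [1]` of the fourfold row: the hidden factor of `(0; 3B̂:3, 7Â:2, 14B̂:2)` lies on the
NON-split component W4.7.3 = `(2, ℚ(√-7), a ≡ 3)` (`three_ne_split_seven_of_even`: `3 ∉ Nm(ℚ(√-7)ˣ)`).
research route conditional on HC_CM; not a corollary; Q11.4-sentence-2 already refuted in dim ≥ 3. [cite: vanGeemen1994HodgeAV, (5.4.1)] -/
theorem twoA7xS3_3B_7A_14B_mk_detH_ne_split :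
    (QuotientGroup.mk (Units.mk0 (622080000 : ℚ) (by norm_num)) : weilNormResidueGroup 7) ≠
      splitDiscriminantClass 2 7 := by
  rw [twoA7xS3_3B_7A_14B_mk_detH_eq_three]
  exact three_ne_split_seven_of_even (by decide)

/-- **`2.A₇ × S₃`, the complex-conjugate datum `(0; 3B̂:3, 14Â:2, 7B̂:2)` (genus 7 921): literal
`det_K H = 2¹³·3⁵·5⁴ = 1244160000`; `1244160000⁻¹·3 = 1/414720000 = (1/57600)² + 7·(1/57600)²`, so the class is `[3]`.**
research route conditional on HC_CM; not a corollary; Q11.4-sentence-2 already refuted in dim ≥ 3. [cite: vanGeemen1994HodgeAV, (5.4.1)] -/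
theorem twoA7xS3_3B_14A_7B_mk_detH_eq_three :
    (QuotientGroup.mk (Units.mk0 (1244160000 : ℚ) (by norm_num)) : weilNormResidueGroup 7) =
      QuotientGroup.mk (Units.mk0 (3 : ℚ) (by norm_num)) := by
  rw [QuotientGroup.eq]
  have e : (Units.mk0 (1244160000 : ℚ) (by norm_num))⁻¹ * Units.mk0 (3 : ℚ) (by norm_num) =
      Units.mk0 ((1 : ℚ) / 414720000) (by norm_num) := Units.ext (by norm_num)
  rw [e]
  exact mem_normUnitsSubgroup_of_sq_add_mul_sq _ ((1 : ℚ) / 57600) ((1 : ℚ) / 57600) (by norm_num)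

/-- … hence NOT the split class: the hidden factor of `(0; 3B̂:3, 14Â:2, 7B̂:2)` lies on W4.7.3 as well.
research route conditional on HC_CM; not a corollary; Q11.4-sentence-2 already refuted in dim ≥ 3. [cite: vanGeemen1994HodgeAV, (5.4.1)] -/
theorem twoA7xS3_3B_14A_7B_mk_detH_ne_split :
    (QuotientGroup.mk (Units.mk0 (1244160000 : ℚ) (by norm_num)) : weilNormResidueGroup 7) ≠
      splitDiscriminantClass 2 7 := by
  rw [twoA7xS3_3B_14A_7B_mk_detH_eq_three]
  exact three_ne_split_seven_of_even (by decide)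

end Summit.HodgeConjecture.HodgeConjecture.Ring2.WeilCoverage

end
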